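import Summits.AtomisticToContinuum.HydrodynamicLimit.Theorems.AntiMazurCoboundariesKineticWindowGronwallWindowRenyiOfIncrementTightness
import Summits.AtomisticToContinuum.HydrodynamicLimit.Theorems.AntiMazurCoboundariesKineticWindowGronwallNodeOfBandAndRenyi
import HarnessLib

/-!
# Content (iii) of the local kinetic node from ONE one-sided statement: the positive tilt of the velocity-exponent increment
# (stub `stub_renyiOfPositiveTilt`, line `board-node-dock` skeleton v3, crux `KineticWindowGronwall`, stmt-AtomisticToContinuum-9282)

Crux `Summit.AtomisticToContinuum.HydrodynamicLimit.Theses.AntiMazurCoboundaries.KineticWindowGronwall`. Stub 1b of skeleton v3 is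
`KineticWindowGronwallNodeOfBandAndRenyi.WindowRenyiLocalGibbs`: order-`p` Rényi quasi-invariance of the local Gibbs class over kinetic windows,
ONE order `p > 1` per `(θm, θM, U, σ)`. By the forward form `∫(ψ∘Φ_{−s}/ψ)^p dλ_N = ∫exp((p−1)(S w − S(Φ_s w)))dλ_N`
(`KineticWindowGronwallWindowRenyiOfIncrementTightnessPrelim.lintegral_renyi_eq_forward`) with `S = Σᵢ ℓ(xᵢ) − Θ`,
`Θ := energyObservable θ₀⁻¹ − momentumObservable (θ₀⁻¹ • u₀)` (the VELOCITY EXPONENT of the local Gibbs density; `Σᵢ‖vᵢ − u₀(xᵢ)‖²/(2θ₀(xᵢ))` up to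
a position-only term), the integrand is `exp((p−1)(−ΔΣℓ + ΔΘ)) ≤ ½ e^{2(p−1)|ΔΣℓ|} + ½ e^{2(p−1)ΔΘ}` (AM–GM); the position factor is
`≤ e^{ε(N+1)}` for every order (`lintegral_exp_ell_increment_le`, path length). HENCE content (iii) follows from ONE one-sided hypothesis:
`PositiveTiltVelocityExponent` — a tilt `c(θm, θM, U, σ) > 0` at which the POSITIVE exponential moment of the kinetic-window increment of `Θ`
is `≤ e^{ε(N+1)}` eventually, uniformly over the class, flows and shifts `0 ≤ s ≤ τ(N+1)^{-1/3}` (take `p = 1 + c/2`). The negative tilts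
`c ∈ [−1, 0]` are free (affinity `≤ 1` / `KineticWindowGronwallBackwardTiltEnergyIncrementFree`), so this positive tilt — excess FORWARD
collisional conduction of the local-frame thermal energy within one kinetic window, at large-deviation scale — is exactly the open dynamical
core of (iii). Folklore; no Theses declaration is concluded, no named fact is used.
-/

noncomputable section

namespace Summit.AtomisticToContinuum.HydrodynamicLimit.Theorems.KineticWindowGronwallRenyiOfPositiveTilt

open _root_.MeasureTheory _root_.Set _root_.Filter
open scoped _root_.ENNReal
open Literature.Analysis.FluidPDE Literature.MathematicalPhysics.KineticTheory
open Summit.AtomisticToContinuum.HydrodynamicLimit.Theorems.KineticWindowGronwallWindowRenyiOfIncrementTightnessPrelim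
  (logW lintegral_renyi_eq_forward)
open Summit.AtomisticToContinuum.HydrodynamicLimit.Theorems.KineticWindowGronwallWindowRenyiOfIncrementTightness
  (lintegral_exp_ell_increment_le)
open Summit.AtomisticToContinuum.HydrodynamicLimit.Theorems.KineticWindowGronwallNodeOfBandAndRenyi (WindowRenyiLocalGibbs)

/-! ## §1 Statements -/

/-- The hard-sphere flow of `N+1` spheres at reduced density `σ` on `𝕋³`. -/
abbrev TFlow (σ : ℝ) (N : ℕ) : Type :=
  HardSphereFlow (Torus.geometry (Fin 3)) (hsDiameter σ N) (N + 1)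

/-- The VELOCITY EXPONENT of the local Gibbs density: `Θ(z) = Σᵢ ‖vᵢ‖²/(2θ₀(xᵢ)) − Σᵢ ⟪u₀(xᵢ)/θ₀(xᵢ), vᵢ⟫`
(`= Σᵢ ‖vᵢ − u₀(xᵢ)‖²/(2θ₀(xᵢ))` minus a position-only term; `log ψ_N = −log Z + Σᵢ ℓ(xᵢ) − Θ`). -/
def velExponent (θ₀ : T3 → ℝ) (u₀ : T3 → V3) {n : ℕ} (z : Config n (Fin 3) T3) : ℝ :=
  energyObservable (fun x => (θ₀ x)⁻¹) z - momentumObservable (fun x => (θ₀ x)⁻¹ • u₀ x) z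

/-- **The ONE-SIDED open core of content (iii): `PositiveTiltVelocityExponent`.** A packing guard `η₁ > 0` such that for every
temperature range, drift bound and `σ > 0` there is ONE tilt `c > 0` such that for every continuous datum of the class (with the guard) and
every flow family the POSITIVE exponential moment `∫ exp(c (Θ(Φ_s z) − Θ(z))) dλ_N` of the kinetic-window increment of the velocity exponent
is `≤ e^{ε(N+1)}` eventually in `N`, uniformly over shifts `0 ≤ s ≤ τ(N+1)^{-1/3}`. Conjecture-grade (dynamical: excess forward collisional
conduction of local-frame thermal energy within a kinetic window at LD scale; heuristically super-exponentially unlikely). -/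
def PositiveTiltVelocityExponent : Prop :=
  ∃ η₁ : ℝ, 0 < η₁ ∧ ∀ (θm θM U : ℝ), 0 < θm → θm ≤ θM → 0 ≤ U → ∀ σ : ℝ, 0 < σ →
    ∃ c : ℝ, 0 < c ∧
    ∀ (a θ₀ : T3 → ℝ) (u₀ : T3 → V3), Continuous a → Continuous θ₀ → Continuous u₀ →
    (∀ x, 0 < a x) → (∀ x, θm ≤ θ₀ x) → (∀ x, θ₀ x ≤ θM) → (∀ x, ‖u₀ x‖ ≤ U) →
    σ ^ 3 * (⨆ x, a x) ≤ η₁ * ∫ x, a x →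
    ∀ Φ : (N : ℕ) → TFlow σ N,
    ∀ τ ε : ℝ, 0 < τ → 0 < ε → ∃ N₀ : ℕ, ∀ N : ℕ, N₀ ≤ N → ∀ s : ℝ, 0 ≤ s →
      s ≤ τ * ((N : ℝ) + 1) ^ (-(1 / 3 : ℝ)) →
      ∫⁻ z, ENNReal.ofReal (Real.exp (c * (velExponent θ₀ u₀ ((Φ N).flow s z) - velExponent θ₀ u₀ z)))
        ∂(localGibbsLaw σ a u₀ θ₀ N (Φ N)) ≤ ENNReal.ofReal (Real.exp (ε * ((N : ℝ) + 1)))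

/-- Helper statement `RenyiOfPositiveTilt` (registered helper stub `stub_renyiOfPositiveTilt`): the one-sided positive tilt gives stub 1b of
skeleton v3, `KineticWindowGronwallNodeOfBandAndRenyi.WindowRenyiLocalGibbs`. Route-internal, not a cited fact. -/
def RenyiOfPositiveTilt : Prop :=
  PositiveTiltVelocityExponent → WindowRenyiLocalGibbs

/-! ## §2 Tools -/

/-- AM–GM for two exponentials, in `ℝ≥0∞`: `exp(t(y − x)) ≤ ½ e^{2t|x|} + ½ e^{2ty}` (`t ≥ 0`). [folklore] -/
theorem ofReal_exp_mul_sub_le (t x y : ℝ) (ht : 0 ≤ t) :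
    ENNReal.ofReal (Real.exp (t * (y - x))) ≤
      2⁻¹ * (ENNReal.ofReal (Real.exp (2 * t * |x|)) + ENNReal.ofReal (Real.exp (2 * t * y))) := by
  have h1 : Real.exp (t * (y - x)) ≤ 2⁻¹ * (Real.exp (2 * t * |x|) + Real.exp (2 * t * y)) := by
    have ha : Real.exp (t * (y - x)) = Real.exp (-(t * x)) * Real.exp (t * y) := by
      rw [← Real.exp_add]; congr 1; ring
    have hb : Real.exp (-(t * x)) ≤ Real.exp (t * |x|) :=
      Real.exp_le_exp.2 (by nlinarith [neg_abs_le x, le_abs_self x])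
    have e1 : Real.exp (t * |x|) ^ 2 = Real.exp (2 * t * |x|) := by rw [← Real.exp_nat_mul]; push_cast; ring_nf
    have e2 : Real.exp (t * y) ^ 2 = Real.exp (2 * t * y) := by rw [← Real.exp_nat_mul]; push_cast; ring_nf
    have hsq : 2 * (Real.exp (t * |x|) * Real.exp (t * y)) ≤ Real.exp (2 * t * |x|) + Real.exp (2 * t * y) := by
      rw [← e1, ← e2]; nlinarith [sq_nonneg (Real.exp (t * |x|) - Real.exp (t * y))]
    have hc : Real.exp (-(t * x)) * Real.exp (t * y) ≤ Real.exp (t * |x|) * Real.exp (t * y) :=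
      mul_le_mul_of_nonneg_right hb (Real.exp_pos _).le
    rw [ha]
    linarith
  refine (ENNReal.ofReal_le_ofReal h1).trans_eq ?_
  rw [ENNReal.ofReal_mul (by norm_num), ENNReal.ofReal_add (Real.exp_pos _).le (Real.exp_pos _).le,
    ENNReal.ofReal_inv_of_pos two_pos, ENNReal.ofReal_ofNat]

/-- The two copies of the local Gibbs density (`WindowClauseOfRenyi`'s, used by stub 1b, and the Prelim's, used by the forward form) are
the same term. [folklore] -/
theorem lgDensity_eq : @KineticWindowGronwallWindowClauseOfRenyi.lgDensity =
    @KineticWindowGronwallWindowRenyiOfIncrementTightnessPrelim.lgDensity := rfl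

/-! ## §3 The reduction -/

/-- **`stub_renyiOfPositiveTilt`: `RenyiOfPositiveTilt` holds** — `p := 1 + c/2`; `Z = 0` trivial; `Z > 0`: forward form, AM–GM into the
position factor (every order, `lintegral_exp_ell_increment_le`) and the positive tilt of the velocity-exponent increment (hypothesis), each at
precision `ε`. [folklore] -/
theorem stub_renyiOfPositiveTilt : RenyiOfPositiveTilt := by
  rintro ⟨η₁, hη₁, H⟩
  refine ⟨η₁, hη₁, fun θm θM U hθm hθmM hU σ hσ => ?_⟩
  obtain ⟨c, hc, Hc⟩ := H θm θM U hθm hθmM hU σ hσ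
  refine ⟨1 + c / 2, by linarith, ?_⟩
  intro a θ₀ u₀ ha hθ hu ha0 hθm_le hθM_ge hU_le hguard Φ τ ε hτ hε
  have hθ0 : ∀ x, 0 < θ₀ x := fun x => hθm.trans_le (hθm_le x)
  obtain ⟨N₁, hN₁⟩ := Hc a θ₀ u₀ ha hθ hu ha0 hθm_le hθM_ge hU_le hguard Φ τ ε hτ hε
  obtain ⟨N₂, hN₂⟩ := lintegral_exp_ell_increment_le ha hθ hu ha0 hθ0 σ Φ (q := c) hc τ hε
  refine ⟨max N₁ N₂, fun N hN s hs0 hs => ?_⟩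
  have h1 := hN₁ N (le_of_max_le_left hN) s hs0 hs
  have h2 := hN₂ N (le_of_max_le_right hN) s hs0 hs
  rw [lgDensity_eq]
  -- the degenerate case `Z = 0`: the law is the zero measure
  rcases (Literature.MathematicalPhysics.KineticTheory.canonicalPartition_nonneg (Torus.geometry (Fin 3))
    (hsDiameter σ N) (N + 1) (f := localGibbsProfile a u₀ θ₀)
    (localGibbsProfile_nonneg (fun x => (ha0 x).le) fun x => (hθ0 x).le)).eq_or_lt with hZ | hZ
  · have hψ : KineticWindowGronwallWindowRenyiOfIncrementTightnessPrelim.lgDensity σ a θ₀ u₀ N = 0 := by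
      funext z
      simp [KineticWindowGronwallWindowRenyiOfIncrementTightnessPrelim.lgDensity, canonicalDensity, ← hZ]
    have hlaw : localGibbsLaw σ a u₀ θ₀ N (Φ N) = 0 := by
      change (KineticWindowGronwallWindowRenyiOfIncrementTightnessPrelim.liou σ N).withDensity
        (KineticWindowGronwallWindowRenyiOfIncrementTightnessPrelim.lgDensity σ a θ₀ u₀ N) = 0
      rw [hψ, withDensity_zero]
    rw [hlaw, lintegral_zero_measure]
    exact zero_le
  -- `Z > 0`: forward form and AM–GM
  rw [lintegral_renyi_eq_forward (Φ N) ha hθ hu ha0 hθ0 hZ s (1 + c / 2)]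
  set P := localGibbsLaw σ a u₀ θ₀ N (Φ N) with hP
  set X : Config (N + 1) (Fin 3) T3 → ℝ := fun w =>
    ∑ i, KineticWindowGronwallWindowRenyiOfIncrementTightnessPrelim.ell a θ₀ u₀ ((Φ N).flow s w i).1 -
      ∑ i, KineticWindowGronwallWindowRenyiOfIncrementTightnessPrelim.ell a θ₀ u₀ (w i).1 with hX
  set Y : Config (N + 1) (Fin 3) T3 → ℝ := fun w => velExponent θ₀ u₀ ((Φ N).flow s w) - velExponent θ₀ u₀ w with hY
  have hid : ∀ w, (1 + c / 2 - 1) * (logW a θ₀ u₀ w - logW a θ₀ u₀ ((Φ N).flow s w)) = c / 2 * (Y w - X w) := by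
    intro w
    simp only [hX, hY, logW, velExponent]
    ring
  have hpt : ∀ w, ENNReal.ofReal (Real.exp ((1 + c / 2 - 1) * (logW a θ₀ u₀ w - logW a θ₀ u₀ ((Φ N).flow s w)))) ≤
      2⁻¹ * (ENNReal.ofReal (Real.exp (c * |X w|)) + ENNReal.ofReal (Real.exp (c * Y w))) := by
    intro w
    rw [hid]
    have h := ofReal_exp_mul_sub_le (c / 2) (X w) (Y w) (by positivity)
    rwa [show 2 * (c / 2) = c by ring] at h
  have hXm : Measurable fun w => ENNReal.ofReal (Real.exp (c * |X w|)) := by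
    have hℓ := (KineticWindowGronwallWindowRenyiOfIncrementTightnessPrelim.continuous_ell ha hθ hu ha0 hθ0).measurable
    have hS : Measurable fun w : Config (N + 1) (Fin 3) T3 =>
        ∑ i, KineticWindowGronwallWindowRenyiOfIncrementTightnessPrelim.ell a θ₀ u₀ (w i).1 :=
      Finset.measurable_sum _ fun i _ => hℓ.comp (measurable_pi_apply i).fst
    exact (measurable_const.mul ((hS.comp ((Φ N).measurable_flow s)).sub hS).abs).exp.ennreal_ofReal
  calc ∫⁻ w, ENNReal.ofReal (Real.exp ((1 + c / 2 - 1) * (logW a θ₀ u₀ w - logW a θ₀ u₀ ((Φ N).flow s w)))) ∂P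
      ≤ ∫⁻ w, 2⁻¹ * (ENNReal.ofReal (Real.exp (c * |X w|)) + ENNReal.ofReal (Real.exp (c * Y w))) ∂P :=
        lintegral_mono hpt
    _ = 2⁻¹ * ((∫⁻ w, ENNReal.ofReal (Real.exp (c * |X w|)) ∂P) + ∫⁻ w, ENNReal.ofReal (Real.exp (c * Y w)) ∂P) := by
        rw [lintegral_const_mul' _ _ (by norm_num), lintegral_add_left hXm]
    _ ≤ 2⁻¹ * (ENNReal.ofReal (Real.exp (ε * ((N : ℝ) + 1))) + ENNReal.ofReal (Real.exp (ε * ((N : ℝ) + 1)))) := by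
        gcongr
    _ = ENNReal.ofReal (Real.exp (ε * ((N : ℝ) + 1))) := by
        rw [← two_mul, ← mul_assoc, ENNReal.inv_mul_cancel (by norm_num) (by norm_num)]
        simp

end Summit.AtomisticToContinuum.HydrodynamicLimit.Theorems.KineticWindowGronwallRenyiOfPositiveTilt

end
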